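import Mathlib
import Summits.MatrixMultiplication.MatrixMultiplication.Theses.LevelGradedCohnUmans
import Summits.MatrixMultiplication.MatrixMultiplication.Theorems.LevelGradedCohnUmansGradedDesignFamilyWreathLink
import Summits.MatrixMultiplication.MatrixMultiplication.Theorems.LevelGradedCohnUmansGradedDesignFamilyAbelianAxisFamily

/-!
# The crux's clause holds at every exponent `2 + ε`, `ε ≥ 0.82` — from an ABELIAN base via the wreath lift

Route `LevelGradedCohnUmans`, crux `GradedDesignFamily` (stmt-MatrixMultiplication-7610), line `Sketch`.
Kernel-checked range of the crux before this line: `ε > 1` (`Negative/LoadBearing.witness_of_one_lt`,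
the `Z/2` matrix–vector design), and NO abelian host can realise a single graded design at `ε ≤ 1`
(`exists_abelian_witness_iff`).  The graded Cohn–Kleinberg–Szegedy–Umans wreath lift of this line
(`gradedWreathLinkAt`) fed with CKSU's two-piece axis family in `C₁₇³` (`abelianAxisFamily_of_le`,
§5, arXiv Prop. 28: an abelian BASE, `J = ⊤`) gives the clause at every `ε ≥ 0.82` — the non-abelian host is
the permutation wreath product `(T → (C₁₇³)^N) ⋊ Perm T` built by the lift.  This is the bound
`ω ≤ 2.82` of CKSU 2005 (arXiv Prop. 28 + Thm. 5.5) made a finite statement inside the graded frame.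
[cite: CohnKleinbergSzegedyUmans2005, §5 (arXiv Prop. 28), §7 Thm. 7.1 (arXiv Thm. 38)]
-/

noncomputable section

set_option linter.dupNamespace false

open scoped BigOperators
open Literature.RepresentationTheory.FiniteGroups
open Summit.MatrixMultiplication.MatrixMultiplication.Theses.LevelGradedCohnUmans

namespace Summit.MatrixMultiplication.MatrixMultiplication.Theorems.GradedDesignFamily

/-- **The clause of `GradedDesignFamily` at every `ε ≥ 0.82`**: a finite group `G`, a bi-invariant
test space `J` and a `J`-separated triple beating the graded budget at exponent `2 + ε`
(`gradedWreathLinkAt ∘ abelianAxisFamily_of_le`). [cite: CohnKleinbergSzegedyUmans2005, §5 (arXiv Prop. 28)] -/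
theorem cruxAt_of_le_082 (ε : ℝ) (hε : (41 : ℝ) / 50 ≤ ε) :
    ∃ (G : Type) (_ : Group G) (_ : Fintype G) (J : Submodule ℂ (G → ℂ)) (X Y Z : Finset G),
      (∀ f ∈ J, ∀ a b : G, (fun g : G => f (a * g * b)) ∈ J) ∧
      (∀ x₀ ∈ X, ∀ z₀ ∈ Z, ∃ f ∈ J, ∀ x ∈ X, ∀ y ∈ Y, ∀ y' ∈ Y, ∀ z ∈ Z,
        (x = x₀ ∧ y = y' ∧ z = z₀ → f (x⁻¹ * y * y'⁻¹ * z) = 1) ∧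
        (¬ (x = x₀ ∧ y = y' ∧ z = z₀) → f (x⁻¹ * y * y'⁻¹ * z) = 0)) ∧
      (∑ᶠ χ ∈ Literature.RepresentationTheory.FiniteGroups.irrChars G ∩ (J : Set (G → ℂ)),
        (χ 1).re ^ (2 + ε)) < ((X.card * Y.card * Z.card : ℕ) : ℝ) ^ ((2 + ε) / 3) :=
  gradedWreathLinkAt ε (by linarith) (abelianAxisFamily_of_le ε hε)

end Summit.MatrixMultiplication.MatrixMultiplication.Theorems.GradedDesignFamily

end
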